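import Summits.Schanuel.Schanuel.Theses.RoyCriterion
import Summits.Schanuel.Schanuel.Theorems.RoySmallValueDirichletGap.Negative.TauLtOneAndCountLeDegreeFalse
import Summits.Schanuel.Schanuel.Theorems.RoyCriterionRankOne

/-!
# Calibration of the derivative exponent in Roy's criterion (negative lemma for crux `stmt-Schanuel-0463`)

Crux `Summit.Schanuel.Schanuel.Theses.RoyCriterion.RoyThesisTyped = ∀ n, RoyCriterion n` (Roy 2001,
Acta Arith. 97, §1, Conjecture 2). In the hypothesis `RoyHypothesis y α s₀ s₁ t₀ t₁ u` the
derivatives `D^k P_N` are required small for `k ≤ N^{s₀}`, where `s₀` is tied to the window (1)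
(`max{1, t₀, 2t₁} < min{s₀, 2s₁}`). Decouple the derivative range: `k ≤ N^{s}` for a fixed
exponent `s`, the window for `(s₀, s₁, t₀, t₁, u)` untouched (the crux is the case `s = s₀`).

* `RoyThesisTyped.royHypothesis_one_one` — for `0 ≤ s < min(t₁, 1)` the decoupled hypothesis
  HOLDS at the algebraic point `(y, α) = (1, 1)`: `P_N = (X₁ − 1)^{⌊N^s⌋+1}` (exact multiplicity
  on the `D`-invariant line `X₁ = 1`, height `≤ 2^{⌊N^s⌋+1} ≤ e^N`).
* `royCriterion_false_with_derivative_exponent_lt_one` — hence for EVERY `0 ≤ s < 1` the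
  decoupled criterion is FALSE (admissible windows have `t₁` filling `(0,1)`; take one with
  `t₁ > s`). By the tree's proof of Roy's Proposition 3 (`RoyCriterionProp3Proofs.lean`, which uses
  of the window only `max{1, t₀, 2t₁} < s₀`, `t₁ ≤ s₁`, `2t₁ < u`) the decoupled statement is TRUE,
  given Schanuel, for `s > max{1, t₀, 2t₁}`: the crux sits inside the true range. Calibration of the
  encoding, not a threat to the crux.
* `RoyThesisTyped.royCriterion_derivExp_of_schanuelRank` — the UPPER side, kernel-checked: under
  `SchanuelRank l`, the decoupled criterion in rank `l` holds for every `s` with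
  `max{1, t₀, 2t₁} < min{s, 2s₁} < u` (Prop. 3 + Roy's scaling argument §5, 1°); and
  `RoyThesisTyped.royCriterion_one_derivExp` — rank one UNCONDITIONALLY (Hermite–Lindemann). So the
  honest threshold for the derivative exponent lies in `[t₁, max{1, t₀, 2t₁}]`.

Reuses the `(X₂ − 1)ⁿ` toolkit of `RoySmallValueDirichletGap/Negative/TauLtOneAndCountLeDegreeFalse.lean`.
Everything is proved; no defs, no named facts.
-/

set_option linter.dupNamespace false

noncomputable section

namespace Summit.Schanuel.Schanuel.Theorems

open MvPolynomial Filter Complex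
open Literature.NumberTheory.Transcendental
open Summit.Schanuel.Schanuel.Theorems.RoySmallValueDirichletGapTauCount
  (aeval_iterate_royD_pow_eq_zero X_one_sub_one_ne_zero mvPolyHeight_pow_X_one_sub_one_le
   totalDegree_pow_X_one_sub_one_le eventually_nat_mul_rpow_le_rpow)

/-- `deg_{X₀} (X₁ − 1)ⁿ = 0`. [folklore] -/
theorem RoyThesisTyped.degreeOf_zero_pow_X_one_sub_one (n : ℕ) :
    ((X 1 - 1 : MvPolynomial (Fin 2) ℤ) ^ n).degreeOf 0 = 0 := by
  have h1 : (X 1 - 1 : MvPolynomial (Fin 2) ℤ).degreeOf 0 = 0 := by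
    have := degreeOf_sub_le 0 (X 1 : MvPolynomial (Fin 2) ℤ) 1
    rw [degreeOf_X, degreeOf_one] at this
    simpa using this
  have := degreeOf_pow_le 0 (X 1 - 1 : MvPolynomial (Fin 2) ℤ) n
  rw [h1, mul_zero] at this
  exact Nat.le_zero.mp this

/-- **The small-value hypothesis with derivative exponent `s` (`k ≤ N^s`), `0 ≤ s < min(t₁, 1)`,
HOLDS at the algebraic point `(y, α) = (1, 1)`**, for any `s₁, t₀, u`: `P_N = (X₁ − 1)^{⌊N^s⌋+1}`
has `X₀`-degree `0`, `X₁`-degree `≤ 2N^s ≤ N^{t₁}`, height `≤ 2^{⌊N^s⌋+1} ≤ e^N`, and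
`D^k P_N` vanishes on the line `X₁ = 1 ∋ (m, 1^m)` for `k ≤ N^s` (exact multiplicity).
[folklore] -/
theorem RoyThesisTyped.royHypothesis_one_one {s s₁ t₀ t₁ u : ℝ} (hs0 : 0 ≤ s) (hst : s < t₁)
    (hs1 : s < 1) : RoyHypothesis ![(1 : ℂ)] ![(1 : ℂ)] s s₁ t₀ t₁ u := by
  unfold RoyHypothesis
  filter_upwards [eventually_nat_mul_rpow_le_rpow 2 hst, eventually_nat_mul_rpow_le_rpow 2 hs1,
    eventually_ge_atTop 1] with N h1 h2 hN1
  set n : ℕ := ⌊(N : ℝ) ^ s⌋₊ + 1 with hn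
  have hnle : (n : ℝ) ≤ 2 * (N : ℝ) ^ s := by
    have hx1 : (1 : ℝ) ≤ (N : ℝ) := by exact_mod_cast hN1
    have hNs1 : (1 : ℝ) ≤ (N : ℝ) ^ s := Real.one_le_rpow hx1 hs0
    have hfl := Nat.floor_le (Real.rpow_nonneg (Nat.cast_nonneg N) s)
    rw [hn]; push_cast; linarith
  have hnN : (n : ℝ) ≤ N := by
    rw [Real.rpow_one] at h2
    linarith [h2]
  refine ⟨(X 1 - 1) ^ n, pow_ne_zero _ X_one_sub_one_ne_zero, ?_, ?_, ?_, ?_⟩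
  · rw [RoyThesisTyped.degreeOf_zero_pow_X_one_sub_one]
    simpa using Real.rpow_nonneg (Nat.cast_nonneg N) t₀
  · calc ((((X 1 - 1 : MvPolynomial (Fin 2) ℤ) ^ n).degreeOf 1 : ℕ) : ℝ) ≤ n := by
          exact_mod_cast (degreeOf_le_totalDegree _ _).trans (totalDegree_pow_X_one_sub_one_le n)
      _ ≤ 2 * (N : ℝ) ^ s := hnle
      _ ≤ (N : ℝ) ^ t₁ := h1
  · have h2e : (2 : ℝ) ≤ Real.exp 1 := by
      have := Real.add_one_le_exp (1 : ℝ); norm_num at this ⊢; linarith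
    calc ((mvPolyHeight ((X 1 - 1 : MvPolynomial (Fin 2) ℤ) ^ n) : ℕ) : ℝ) ≤ (2 : ℝ) ^ n := by
          exact_mod_cast mvPolyHeight_pow_X_one_sub_one_le n
      _ ≤ (Real.exp 1) ^ n := pow_le_pow_left₀ (by norm_num) h2e n
      _ = Real.exp n := by rw [← Real.exp_nat_mul, mul_one]
      _ ≤ Real.exp N := Real.exp_le_exp.mpr hnN
  · intro k m hk hm
    have hpt : (![∑ j, (m j : ℂ) * (![(1 : ℂ)] : Fin 1 → ℂ) j,
        ∏ j, (![(1 : ℂ)] : Fin 1 → ℂ) j ^ m j] : Fin 2 → ℂ) = ![(m 0 : ℂ), 1] := by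
      rw [Fin.sum_univ_one, Fin.prod_univ_one]; simp
    rw [hpt]
    have hkn : k < n := by
      rw [hn]; exact Nat.lt_succ_of_le (Nat.le_floor hk)
    rw [aeval_iterate_royD_pow_eq_zero _ hkn, norm_zero]
    exact (Real.exp_pos _).le

/-- `ℚ(1, 1)` is algebraic. [folklore] -/
theorem RoyThesisTyped.isAlgebraic_adjoin_one_one :
    Algebra.IsAlgebraic ℚ ↥(IntermediateField.adjoin ℚ
      (Set.range (![(1 : ℂ)] : Fin 1 → ℂ) ∪ Set.range (![(1 : ℂ)] : Fin 1 → ℂ))) := by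
  apply IntermediateField.isAlgebraic_adjoin
  rintro x (⟨i, rfl⟩ | ⟨i, rfl⟩) <;> fin_cases i <;> simpa using isIntegral_one

/-- **CALIBRATION OF THE DERIVATIVE EXPONENT.** Replace, in the hypothesis of `RoyCriterion l` only,
the derivative range `k ≤ N^{s₀}` by `k ≤ N^{s}` for a fixed exponent `s` (the window (1) for
`(s₀, s₁, t₀, t₁, u)` untouched; the crux is the coupled case `s = s₀ > max{1, t₀, 2t₁}`). For
EVERY `0 ≤ s < 1` the resulting statement is FALSE: choose an admissible window with `t₁ > s`
(possible exactly because admissible `t₁` fill `(0, 1)`) and the algebraic point `(1, 1)` of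
`royHypothesis_one_one`. So a proof must use derivatives of order beyond `N^{t₁}` (multiplicity)
and beyond the log-height scale `N` — both built into `s₀ > max{1, 2t₁}`; by the tree's proof of
Roy's Proposition 3 the decoupled statement is TRUE (given Schanuel) as soon as
`s > max{1, t₀, 2t₁}`, so this calibrates, and does not threaten, the crux.
[cite: Roy2001, §1 (1) and Prop. 3] -/
theorem royCriterion_false_with_derivative_exponent_lt_one {s : ℝ} (hs0 : 0 ≤ s) (hs1 : s < 1) :
    ¬ (∀ (l : ℕ) (y α : Fin l → ℂ), LinearIndependent ℚ y → (∀ j, α j ≠ 0) →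
      ∀ (s₀ s₁ t₀ t₁ u : ℝ), RoyAdmissible s₀ s₁ t₀ t₁ u → RoyHypothesis y α s s₁ t₀ t₁ u →
        (l : Cardinal) ≤ Algebra.trdeg ℚ
          ↥(IntermediateField.adjoin ℚ (Set.range y ∪ Set.range α))) := by
  intro h
  have hli : LinearIndependent ℚ (![(1 : ℂ)] : Fin 1 → ℂ) :=
    linearIndependent_unique_iff.mpr (by simp)
  haveI := RoyThesisTyped.isAlgebraic_adjoin_one_one
  rcases lt_or_ge s (3 / 4) with hs | hs
  · -- fixed window (1.55, 0.8, 1.5, 0.75, 1.6), t₁ = 0.75 > s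
    have hadm : RoyAdmissible 1.55 0.8 1.5 0.75 1.6 := by
      refine ⟨by norm_num, by norm_num, by norm_num, by norm_num, by norm_num, ?_, ?_, by norm_num⟩ <;>
        norm_num
    have hcon := h 1 ![1] ![1] hli (by simp) _ _ _ _ _ hadm
      (RoyThesisTyped.royHypothesis_one_one hs0 (by norm_num; linarith) hs1)
    rw [trdeg_eq_zero] at hcon
    simp at hcon
  · -- window (2b+ε, b+ε, 2b, b, 2b+2ε), b = (s+1)/2 ∈ [7/8, 1), ε = (1−b)/5
    set b : ℝ := (s + 1) / 2 with hb
    set ε : ℝ := (1 - b) / 5 with hε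
    have hb1 : b < 1 := by rw [hb]; linarith
    have hb0 : 7 / 8 ≤ b := by rw [hb]; linarith
    have hε0 : 0 < ε := by rw [hε]; linarith
    have hadm : RoyAdmissible (2 * b + ε) (b + ε) (2 * b) b (2 * b + 2 * ε) := by
      refine ⟨by linarith, by linarith, by linarith, by linarith, by linarith, ?_, ?_, ?_⟩
      · refine max_lt (lt_min (by linarith) (by linarith))
          (max_lt (lt_min (by linarith) (by linarith)) (lt_min (by linarith) (by linarith)))
      · exact max_lt (by linarith) (by linarith)
      · rw [hε]; linarith
    have hcon := h 1 ![1] ![1] hli (by simp) _ _ _ _ _ hadm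
      (RoyThesisTyped.royHypothesis_one_one hs0 (by rw [hb]; linarith) hs1)
    rw [trdeg_eq_zero] at hcon
    simp at hcon

/-- **Upper side of the derivative-exponent calibration.** With the derivative range decoupled
(`k ≤ N^s`) and only Roy's Proposition-3 inequalities `max{1, t₀, 2t₁} < min{s, 2s₁} < u` on the
parameters (no upper constraint on `u`, no `max{s, s₁+t₁} < u`), Schanuel in rank `l` already gives
the decoupled criterion in rank `l`: Proposition 3 (tree theorem `Roy2001_prop3_holds`) makes every
`αⱼ e^{−yⱼ}` torsion, and the scaling argument of Roy 2001 §5, 1° concludes.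
[cite: Roy2001, Prop. 3 and §5 (1°)] -/
theorem RoyThesisTyped.royCriterion_derivExp_of_schanuelRank {l : ℕ} (hS : SchanuelRank l)
    (y α : Fin l → ℂ) (hy : LinearIndependent ℚ y) (hα : ∀ j, α j ≠ 0)
    {s s₁ t₀ t₁ u : ℝ} (hs : 0 < s) (hs₁ : 0 < s₁) (ht₀ : 0 < t₀) (ht₁ : 0 < t₁) (hu : 0 < u)
    (h1 : max 1 (max t₀ (2 * t₁)) < min s (2 * s₁)) (h2 : min s (2 * s₁) < u)
    (hhyp : RoyHypothesis y α s s₁ t₀ t₁ u) :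
    (l : Cardinal) ≤ Algebra.trdeg ℚ ↥(IntermediateField.adjoin ℚ (Set.range y ∪ Set.range α)) := by
  have hd : ∀ j, RoyConditionA (y j) (α j) := fun j => by
    by_contra hna
    exact Roy2001_prop3_holds (y j) (α j) (hα j) s s₁ t₀ t₁ u hs hs₁ ht₀ ht₁ hu h1 h2 hna
      (royConditionB_of_royHypothesis hhyp j)
  choose d hd1 hd2 using hd
  set D : ℕ := ∏ j, d j with hD
  have hD0 : 0 < D := Finset.prod_pos fun j _ => hd1 j
  have hαD : ∀ j, α j ^ D = cexp (D * y j) := by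
    intro j
    obtain ⟨e, he⟩ : d j ∣ D := Finset.dvd_prod_of_mem _ (Finset.mem_univ j)
    rw [he, pow_mul, hd2 j, ← Complex.exp_nat_mul]
    push_cast; ring_nf
  set y' : Fin l → ℂ := fun j => (D : ℂ) * y j with hy'_def
  have hy' : LinearIndependent ℚ y' := by
    have hDq : (D : ℚ) ≠ 0 := by exact_mod_cast hD0.ne'
    have := hy.units_smul (fun _ => Units.mk0 (D : ℚ) hDq)
    convert this using 1
    ext j
    simp [hy'_def, Units.smul_def, Rat.smul_def]
  have hle : IntermediateField.adjoin ℚ (Set.range y' ∪ Set.range (cexp ∘ y')) ≤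
      IntermediateField.adjoin ℚ (Set.range y ∪ Set.range α) := by
    refine IntermediateField.adjoin_le_iff.mpr ?_
    rintro x (⟨j, rfl⟩ | ⟨j, rfl⟩)
    · exact mul_mem (natCast_mem _ D)
        (IntermediateField.subset_adjoin _ _ (Or.inl ⟨j, rfl⟩))
    · change cexp ((D : ℂ) * y j) ∈ _
      rw [← hαD j]
      exact pow_mem (IntermediateField.subset_adjoin ℚ (Set.range y ∪ Set.range α)
        (Or.inr ⟨j, rfl⟩)) D
  calc (l : Cardinal)
      ≤ Algebra.trdeg ℚ ↥(IntermediateField.adjoin ℚ (Set.range y' ∪ Set.range (cexp ∘ y'))) :=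
        hS y' hy'
    _ ≤ Algebra.trdeg ℚ ↥(IntermediateField.adjoin ℚ (Set.range y ∪ Set.range α)) :=
        trdeg_le_of_injective (IntermediateField.inclusion hle)
          (IntermediateField.inclusion_injective hle)

/-- **Rank one, unconditionally**: the decoupled criterion in rank `1` is TRUE for every derivative
exponent `s` with `max{1, t₀, 2t₁} < min{s, 2s₁} < u` (Hermite–Lindemann gives Schanuel in rank
one, tree theorem `schanuelRank_one_of_transcendental_exp`). Together with
`royCriterion_false_with_derivative_exponent_lt_one` (FALSE for every `s < 1`, in windows with
`t₁ > s`) this brackets the honest threshold for `s` between `t₁` and `max{1, t₀, 2t₁}`.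
[cite: Roy2001, Prop. 3] -/
theorem RoyThesisTyped.royCriterion_one_derivExp (y α : Fin 1 → ℂ) (hy : LinearIndependent ℚ y)
    (hα : ∀ j, α j ≠ 0) {s s₁ t₀ t₁ u : ℝ} (hs : 0 < s) (hs₁ : 0 < s₁) (ht₀ : 0 < t₀)
    (ht₁ : 0 < t₁) (hu : 0 < u) (h1 : max 1 (max t₀ (2 * t₁)) < min s (2 * s₁))
    (h2 : min s (2 * s₁) < u) (hhyp : RoyHypothesis y α s s₁ t₀ t₁ u) :
    (1 : Cardinal) ≤ Algebra.trdeg ℚ ↥(IntermediateField.adjoin ℚ (Set.range y ∪ Set.range α)) := by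
  have h := RoyThesisTyped.royCriterion_derivExp_of_schanuelRank
    (Literature.Transcend.schanuelRank_one_of_transcendental_exp transcendental_exp_holds)
    y α hy hα hs hs₁ ht₀ ht₁ hu h1 h2 hhyp
  simpa using h

end Summit.Schanuel.Schanuel.Theorems

end
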